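import Mathlib

/-!
# Crux `HilbertIntegralOverconvergentIsCongruence` (stmt-Langlands-8485), line `Sketch-ideate-r1-k1`:
# stub `stub_mvKatzNormMul` — norm families of `d`-variable Katz data are stable under products

A Katz datum in `d` variables over a nonarchimedean field `K` is packaged as its generating series
`Φ = Σ_i a_i T^i ∈ (MvPowerSeries σ K)⟦T⟧`; the NORM condition of rate `ρ` and constant `C` is
`‖(a_i)_n‖ ≤ C ρ^i` for all `i, n`.  This stub: the norm condition is stable under the Cauchy product
with constant `C₁ C₂` (ultrametric inequality twice).  `d`-variable analogue of the sibling line's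
`CapacityClassicality.katzNormFamily_mul`.  Theorems only.
-/

set_option linter.dupNamespace false

namespace Summit.Langlands.Langlands.Theorems.HilbertIntegralOverconvergentIsCongruence

/-- **Stub `stub_mvKatzNormMul`.**  For `Φ₁ Φ₂ : PowerSeries (MvPowerSeries σ K)` over a
nonarchimedean normed field `K` with `‖(coeff_i Φ₁)_n‖ ≤ C₁ ρ^i` and `‖(coeff_i Φ₂)_n‖ ≤ C₂ ρ^i`
(`ρ, C₁, C₂ ≥ 0`), the product satisfies `‖(coeff_i (Φ₁ Φ₂))_n‖ ≤ C₁ C₂ ρ^i`. [folklore] -/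
theorem stub_mvKatzNormMul {K σ : Type*} [NormedField K] [IsUltrametricDist K]
    (ρ C₁ C₂ : ℝ) (hρ : 0 ≤ ρ) (hC₁ : 0 ≤ C₁) (hC₂ : 0 ≤ C₂)
    (Φ₁ Φ₂ : PowerSeries (MvPowerSeries σ K))
    (h₁ : ∀ i n, ‖MvPowerSeries.coeff n (PowerSeries.coeff i Φ₁)‖ ≤ C₁ * ρ ^ i)
    (h₂ : ∀ i n, ‖MvPowerSeries.coeff n (PowerSeries.coeff i Φ₂)‖ ≤ C₂ * ρ ^ i) :
    ∀ i n, ‖MvPowerSeries.coeff n (PowerSeries.coeff i (Φ₁ * Φ₂))‖ ≤ C₁ * C₂ * ρ ^ i := by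
  classical
  intro i n
  have h0 : 0 ≤ C₁ * C₂ * ρ ^ i := by positivity
  rw [PowerSeries.coeff_mul, map_sum]
  refine IsUltrametricDist.norm_sum_le_of_forall_le_of_nonneg h0 fun ij hij => ?_
  rw [Finset.HasAntidiagonal.mem_antidiagonal] at hij
  rw [MvPowerSeries.coeff_mul]
  refine IsUltrametricDist.norm_sum_le_of_forall_le_of_nonneg h0 fun ab _ => ?_
  rw [norm_mul]
  calc ‖MvPowerSeries.coeff ab.1 (PowerSeries.coeff ij.1 Φ₁)‖
        * ‖MvPowerSeries.coeff ab.2 (PowerSeries.coeff ij.2 Φ₂)‖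
      ≤ C₁ * ρ ^ ij.1 * (C₂ * ρ ^ ij.2) :=
        mul_le_mul (h₁ _ _) (h₂ _ _) (norm_nonneg _) (by positivity)
    _ = C₁ * C₂ * ρ ^ i := by
        rw [← hij, pow_add]
        ring

end Summit.Langlands.Langlands.Theorems.HilbertIntegralOverconvergentIsCongruence
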